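import Summits.ABC.ABC.Theorems.IsogenyGlueCongruenceEllipticGluingPrimeBoundStubBigImageTorsionCoreAux4
import HarnessLib

/-!
# Big-image torsion core, helpers 5/5: isotypy, `ℓ`-torsion through the corner, the Hom-lattice

Helper file (5/5) for stub `stub_bigImageTorsionCore` ((N†), the big-image torsion core) of
line `Sketch` (isotypic–Minkowski reduction) of crux U
`Summit.ABC.ABC.Theses.IsogenyGlueCongruence.EllipticGluingPrimeBound` (stmt-ABC-13919); the stub
itself is proved in `…EllipticGluingPrimeBoundStubBigImageTorsionCore`.

* `nsmul_id_mem_closure` (registered sub-goal) — over an algebraically closed field of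
  characteristic zero, if `dim E₀ = 1` and every non-zero quotient of `X` receives a non-zero map
  from `E₀`, then `N • 𝟙 X` lies in the ideal spanned by the composites `X → E₀ → X` for some
  `N ≥ 1` (`exists_quasiProjector` of `…StubGeomIsotypicProjector`, Poincaré over `K̄`);
* `mem_closure_corner` — then every `ℓ`-torsion point of `A(K̄)` is a sum of corner values
  `ev f y` with `y ∈ E(K̄)` of `ℓ`-power order (`[n]` is an isogeny, hence onto `A(K̄)`);
* `homGaloisLattice`, `homGaloisLattice'` — `Hom(E_ℚ̄, B_ℚ̄)` is free of rank `≤ 4 dim E dim B`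
  with a `ℤ`-linear action of `Γ_ℚ` (the corner of `galConj`) through a finite quotient, whose
  invariants are the base changes of `ℚ`-homomorphisms (Mumford §19 Thm. 3 and Galois descent,
  from the tree: `module_free_hom_holds`, `finrank_hom_le_holds`, `finite_range_toRingHom_galois`,
  `exists_baseChange_eq_of_forall_galConj_eq`); the proof of `homGaloisLattice` is the line's
  wave-3 plan lemma `substub_homGaloisLattice`.

Everything is proved; no `def`, no named fact. References: D. Mumford, *Abelian Varieties*
(1970), §19, Thm. 1 (Poincaré), Thm. 3; J. S. Milne, *Abelian Varieties* (1986), §12, §16.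
-/

noncomputable section

-- `Summit.<Summit>.<Problem>` is the mandated summit-side namespace (CONVENTIONS §2); for the
-- single-conjunct summit `ABC` the two coincide, so the duplicate `ABC.ABC` is deliberate.
set_option linter.dupNamespace false

namespace Summit.ABC.ABC.Theorems.IsotypicMinkowski

open scoped AddSubgroup

open CategoryTheory CategoryTheory.Limits AlgebraicGeometry
open Literature.AlgebraicGeometry.Motives
open Summit.ABC.ABC.Theses.IsogenyGlueCongruence

/-! ## Isotypy (registered sub-goal of the stub) and the `ℓ`-torsion through the corner -/

section Isotypic

open Literature.AlgebraicGeometry.Motives.AbelianVariety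

/-- **A geometrically `E₀`-isotypic abelian variety is a quotient of a power of `E₀`, up to a
multiple.** Over an algebraically closed field of characteristic zero, if `dim E₀ = 1` and every
non-zero quotient of `X` receives a non-zero homomorphism from `E₀`, then `N • 𝟙 X` lies in the
two-sided ideal of `End X` spanned by the composites `X → E₀ → X` for some `N ≥ 1`:
`exists_quasiProjector` gives `e` in that ideal with `f ≫ e = N • f` for all `f : E₀ → X`; then
`g = N - e` kills every `f`, satisfies `g ≫ g = N • g`, so acts as `[N]` on its image, a non-zero
quotient of `X` which therefore receives no non-zero map from `E₀` — unless `g = 0`. [folklore] -/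
theorem nsmul_id_mem_closure {L : Type} [Field L] [IsAlgClosed L] [CharZero L]
    (E₀ X : AbelianVariety.{0} L) (hE₀ : E₀.dim = 1)
    (hiso : ∀ (C : AbelianVariety.{0} L) (g : X ⟶ C),
      Surjective (AbelianVariety.Hom.toSchemeHom g) → C.dim ≠ 0 → ∃ f : E₀ ⟶ C, f ≠ 0) :
    ∃ N : ℕ, 0 < N ∧ (N • 𝟙 X) ∈
      AddSubgroup.closure {x : X ⟶ X | ∃ (π : X ⟶ E₀) (ι : E₀ ⟶ X), x = π ≫ ι} := by
  obtain ⟨e, N, hN, he, hf⟩ := exists_quasiProjector E₀ hE₀ X.dim X rfl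
  refine ⟨N, hN, ?_⟩
  suffices hg : N • 𝟙 X - e = 0 by rw [sub_eq_zero] at hg; rwa [hg]
  set g := N • 𝟙 X - e with hgdef
  by_contra hg
  have h1 : ∀ f : E₀ ⟶ X, f ≫ g = 0 := fun f ↦ by
    rw [hgdef, Preadditive.comp_sub, Preadditive.comp_nsmul, Category.comp_id, hf, sub_self]
  have h2 : e ≫ g = 0 := by
    refine AddSubgroup.closure_induction (p := fun x _ ↦ x ≫ g = 0) ?_ ?_ ?_ ?_ he
    · rintro x ⟨π, ι, rfl⟩
      rw [Category.assoc, h1, Limits.comp_zero]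
    · exact Limits.zero_comp
    · intro x y _ _ hx hy
      rw [Preadditive.add_comp, hx, hy, add_zero]
    · intro x _ hx
      rw [Preadditive.neg_comp, hx, neg_zero]
  have h3 : g ≫ g = N • g := by
    conv_lhs => rw [hgdef]
    rw [Preadditive.sub_comp, Preadditive.nsmul_comp, Category.id_comp, h2, sub_zero]
  have hpos : 0 < (image g).dim := dim_image_pos g hg
  obtain ⟨h, hh⟩ := hiso _ (toImage g) inferInstance hpos.ne'
  have h4 : imageι g ≫ g = N • imageι g := by
    apply eq_of_comp_eq_of_surjective (toImage g)
    rw [← Category.assoc, toImage_imageι, h3, Preadditive.comp_nsmul, toImage_imageι]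
  have h5 : N • (h ≫ imageι g) = 0 := by
    rw [← Preadditive.comp_nsmul, ← h4, ← Category.assoc, h1]
  haveI := isAddTorsionFree_hom_of_charZero (A := E₀) (B := X)
  have h6 : h ≫ imageι g = 0 := (nsmul_eq_zero_iff_right hN.ne').1 h5
  apply hh
  apply eq_of_comp_eq_of_isClosedImmersion (imageι g)
  rw [h6, Limits.zero_comp]

namespace BigImage

variable {K : Type} [Field K] [CharZero K] (E A : AbelianVariety.{0} K)

/-- **Every `ℓ`-torsion point of `A(K̄)` is a sum of corner values `ev f y` with `y ∈ E(K̄)` of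
`ℓ`-power order**, as soon as `[N]_{A_K̄}` lies in the ideal spanned by the composites
`A_K̄ → E_K̄ → A_K̄` (`nsmul_id_mem_closure`): write `N = ℓᵃ N'`, `ℓ ∤ N'`; for `Q ∈ A[ℓ]` pick
`Q'` with `ℓᵃ Q' = c Q` where `N' c ≡ 1 (mod ℓ)` (divisibility of `A(K̄)`, `[ℓᵃ]` being an
isogeny), so that `Q = N Q'`, `ℓ^(a+1) Q' = 0`, and expand `[N](Q')` along the ideal
(`corner_comp`, `corner_nsmul`). [folklore] -/
theorem mem_closure_corner {N : ℕ} (hN : 0 < N)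
    (hmem : (N • 𝟙 (A.baseChange (AlgebraicClosure K))) ∈ AddSubgroup.closure
      {x | ∃ (π : A.baseChange (AlgebraicClosure K) ⟶ E.baseChange (AlgebraicClosure K))
        (ι : E.baseChange (AlgebraicClosure K) ⟶ A.baseChange (AlgebraicClosure K)), x = π ≫ ι})
    {ℓ : ℕ} (hℓ : ℓ.Prime) :
    ∃ k : ℕ, ∀ Q : A.geomPoints, ℓ • Q = 0 →
      Q ∈ AddSubgroup.closure {Q' : A.geomPoints |
        ∃ (f : E.baseChange (AlgebraicClosure K) ⟶ A.baseChange (AlgebraicClosure K))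
          (y : E.geomPoints), (ℓ ^ k) • y = 0 ∧ Q' = AbelianVariety.Hom.geomPointsMap (biprod.snd :
              E ⊞ A ⟶ A)
      (((AddMonoidHom.id (E ⊞ A).geomPoints).comp (MonoidHom.toAdditive ((E ⊞ A).pointsEnd
          (AlgebraicClosure K)
          (AbelianVariety.Hom.baseChange (AlgebraicClosure K) (biprod.fst : E ⊞ A ⟶ E) ≫ f ≫
              AbelianVariety.Hom.baseChange (AlgebraicClosure K) (biprod.inr : A ⟶ E ⊞ A))))).comp
              (AddMonoidHom.id (E ⊞ A).geomPoints)
        (AbelianVariety.Hom.geomPointsMap (biprod.inl : E ⟶ E ⊞ A) y))} := by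
  obtain ⟨a, N', hN', hNeq⟩ := Nat.exists_eq_pow_mul_and_not_dvd hN.ne' ℓ hℓ.ne_one
  refine ⟨a + 1, fun Q hQ ↦ ?_⟩
  -- `c` with `N' c ≡ 1 (mod ℓ)`
  obtain ⟨c, -, hc⟩ := Nat.exists_mul_mod_eq_one_of_coprime
    ((Nat.Prime.coprime_iff_not_dvd hℓ).2 hN').symm hℓ.one_lt
  have hcQ : (N' * c) • Q = Q := by
    conv_lhs => rw [← Nat.div_add_mod (N' * c) ℓ, hc]
    rw [add_smul, one_smul, mul_comm, mul_smul, hQ, smul_zero, zero_add]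
  -- divisibility: `ℓᵃ Q' = c Q`
  obtain ⟨Q', hQ'⟩ : ∃ Q' : A.geomPoints, (ℓ ^ a) • Q' = c • Q := by
    have hiso : IsIsogeny (((ℓ ^ a : ℕ) : ℤ) • 𝟙 A) :=
      isIsogeny_zsmul_id_of_cast_ne_zero (A := A) _
        (by exact_mod_cast pow_ne_zero a hℓ.ne_zero)
    obtain ⟨P₀, hP₀⟩ := hiso.geomPointsMap_surjective (c • Q)
    refine ⟨P₀, ?_⟩
    rw [← hP₀, natCast_zsmul, AbelianVariety.geomPointsMap_nsmul_apply, Hom.geomPointsMap_id,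
      AddMonoidHom.id_apply]
  have hQN : Q = N • Q' := by
    rw [hNeq, mul_comm, mul_smul, hQ', smul_smul, hcQ]
  have hQ'ℓ : (ℓ ^ (a + 1)) • Q' = 0 := by
    rw [pow_succ, mul_comm, mul_smul, hQ', smul_comm, hQ, smul_zero]
  -- expand `[N] Q'` along the ideal
  set C := AddSubgroup.closure {Q' : A.geomPoints |
        ∃ (f : E.baseChange (AlgebraicClosure K) ⟶ A.baseChange (AlgebraicClosure K))
          (y : E.geomPoints), (ℓ ^ (a + 1)) • y = 0 ∧ Q' = AbelianVariety.Hom.geomPointsMap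
              (biprod.snd : E ⊞ A ⟶ A)
      (((AddMonoidHom.id (E ⊞ A).geomPoints).comp (MonoidHom.toAdditive ((E ⊞ A).pointsEnd
          (AlgebraicClosure K)
          (AbelianVariety.Hom.baseChange (AlgebraicClosure K) (biprod.fst : E ⊞ A ⟶ E) ≫ f ≫
              AbelianVariety.Hom.baseChange (AlgebraicClosure K) (biprod.inr : A ⟶ E ⊞ A))))).comp
              (AddMonoidHom.id (E ⊞ A).geomPoints)
        (AbelianVariety.Hom.geomPointsMap (biprod.inl : E ⟶ E ⊞ A) y))} with hC
  have key : ∀ x ∈ AddSubgroup.closure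
      {x | ∃ (π : A.baseChange (AlgebraicClosure K) ⟶ E.baseChange (AlgebraicClosure K))
        (ι : E.baseChange (AlgebraicClosure K) ⟶ A.baseChange (AlgebraicClosure K)), x = π ≫ ι},
      ∀ R : A.geomPoints, (ℓ ^ (a + 1)) • R = 0 →
        AbelianVariety.Hom.geomPointsMap (biprod.snd : E ⊞ A ⟶ A)
          (((AddMonoidHom.id (E ⊞ A).geomPoints).comp (MonoidHom.toAdditive ((E ⊞ A).pointsEnd
              (AlgebraicClosure K)
          (AbelianVariety.Hom.baseChange (AlgebraicClosure K) (biprod.snd : E ⊞ A ⟶ A) ≫ x ≫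
              AbelianVariety.Hom.baseChange (AlgebraicClosure K) (biprod.inr : A ⟶ E ⊞ A))))).comp
              (AddMonoidHom.id (E ⊞ A).geomPoints)
            (AbelianVariety.Hom.geomPointsMap (biprod.inr : A ⟶ E ⊞ A) R)) ∈ C := by
    intro x hx
    refine AddSubgroup.closure_induction (p := fun x _ ↦ ∀ R : A.geomPoints, (ℓ ^ (a + 1)) • R = 0 →
        AbelianVariety.Hom.geomPointsMap (biprod.snd : E ⊞ A ⟶ A)
          (((AddMonoidHom.id (E ⊞ A).geomPoints).comp (MonoidHom.toAdditive ((E ⊞ A).pointsEnd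
              (AlgebraicClosure K)
          (AbelianVariety.Hom.baseChange (AlgebraicClosure K) (biprod.snd : E ⊞ A ⟶ A) ≫ x ≫
              AbelianVariety.Hom.baseChange (AlgebraicClosure K) (biprod.inr : A ⟶ E ⊞ A))))).comp
              (AddMonoidHom.id (E ⊞ A).geomPoints)
            (AbelianVariety.Hom.geomPointsMap (biprod.inr : A ⟶ E ⊞ A) R)) ∈ C) ?_ ?_ ?_ ?_ hx
    · rintro x ⟨π, ι, rfl⟩ R hR
      rw [corner_comp]
      refine AddSubgroup.subset_closure ⟨ι, _, ?_, rfl⟩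
      rw [← map_nsmul, ← map_nsmul, ← map_nsmul, hR, map_zero, map_zero, map_zero]
    · intro R _
      rw [Limits.zero_comp, Limits.comp_zero, act_zero, map_zero]
      exact C.zero_mem
    · intro x y _ _ hx hy R hR
      rw [Preadditive.add_comp, Preadditive.comp_add, act_add, map_add]
      exact C.add_mem (hx R hR) (hy R hR)
    · intro x _ hx R hR
      rw [Preadditive.neg_comp, Preadditive.comp_neg, act_neg, map_neg]
      exact C.neg_mem (hx R hR)
  rw [hQN, ← corner_nsmul E A N Q']
  exact key _ hmem Q' hQ'ℓ

end BigImage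

end Isotypic

namespace BigImage

/-! ## The Galois lattice `Hom(E_ℚ̄, B_ℚ̄)` -/

/-- **(B) The Hom-lattice with its Galois action** (proof taken over from the line's wave-3 plan
file, lemma `substub_homGaloisLattice`). For abelian
varieties `E`, `B` over `ℚ`, `H = Hom(E_ℚ̄, B_ℚ̄)` is a finitely generated free `ℤ`-module of rank
`≤ 4 · dim E · dim B` (tree: `module_free_hom_holds`, `module_finite_hom_holds`,
`finrank_hom_le_holds`, `dim_baseChange`), and `Gal(ℚ̄/ℚ)` acts on it `ℤ`-linearly by the corner of
the Galois action `galConj` on `End((E ⊞ B)_ℚ̄)` (`σ • f = inl ≫ σ(fst ≫ f ≫ inr) ≫ snd`), through a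
FINITE quotient (`finite_range_toRingHom_galois`), with fixed points exactly the base changes of
`ℚ`-homomorphisms (`exists_baseChange_eq_of_forall_galConj_eq`, `galConj_baseChange`). Statement
only this cycle (Lean M–L, all inputs in the tree; the points formula `(σ • f)(σ P) = σ (f P)` on
`E(ℚ̄)`, from `pointsEnd_galConj`, is `corner_ev_smul`). [folklore] -/
theorem homGaloisLattice (E B : AbelianVariety.{0} ℚ) :
    Module.Free ℤ (E.baseChange (AlgebraicClosure ℚ) ⟶ B.baseChange (AlgebraicClosure ℚ)) ∧
    Module.Finite ℤ (E.baseChange (AlgebraicClosure ℚ) ⟶ B.baseChange (AlgebraicClosure ℚ)) ∧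
    Module.finrank ℤ (E.baseChange (AlgebraicClosure ℚ) ⟶ B.baseChange (AlgebraicClosure ℚ)) ≤
      4 * E.dim * B.dim ∧
    ∃ ρ : Representation ℤ (AlgebraicClosure ℚ ≃ₐ[ℚ] AlgebraicClosure ℚ)
        (E.baseChange (AlgebraicClosure ℚ) ⟶ B.baseChange (AlgebraicClosure ℚ)),
      (∀ (σ : AlgebraicClosure ℚ ≃ₐ[ℚ] AlgebraicClosure ℚ)
          (f : E.baseChange (AlgebraicClosure ℚ) ⟶ B.baseChange (AlgebraicClosure ℚ)),
          ρ σ f = AbelianVariety.Hom.baseChange (AlgebraicClosure ℚ) (biprod.inl : E ⟶ E ⊞ B) ≫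
            (E ⊞ B).galConj (AlgebraicClosure ℚ) σ
              (AbelianVariety.Hom.baseChange (AlgebraicClosure ℚ) (biprod.fst : E ⊞ B ⟶ E) ≫ f ≫
                AbelianVariety.Hom.baseChange (AlgebraicClosure ℚ) (biprod.inr : B ⟶ E ⊞ B)) ≫
            AbelianVariety.Hom.baseChange (AlgebraicClosure ℚ) (biprod.snd : E ⊞ B ⟶ B)) ∧
      (Set.range ρ).Finite ∧
      ∀ f : E.baseChange (AlgebraicClosure ℚ) ⟶ B.baseChange (AlgebraicClosure ℚ),
        (∀ σ : AlgebraicClosure ℚ ≃ₐ[ℚ] AlgebraicClosure ℚ, ρ σ f = f) ↔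
          ∃ f₀ : E ⟶ B, AbelianVariety.Hom.baseChange (AlgebraicClosure ℚ) f₀ = f := by
  haveI := normal_algebraicClosure_rat
  refine ⟨AbelianVariety.module_free_hom_holds _ _, AbelianVariety.module_finite_hom_holds _ _,
    ?_, ?_⟩
  · have h : Module.finrank ℤ (E.baseChange (AlgebraicClosure ℚ) ⟶ B.baseChange (AlgebraicClosure
      ℚ))
        ≤ 4 * (E.baseChange (AlgebraicClosure ℚ)).dim * (B.baseChange (AlgebraicClosure ℚ)).dim :=
      AbelianVariety.finrank_hom_le_holds _ _
    rwa [AbelianVariety.dim_baseChange, AbelianVariety.dim_baseChange] at h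
  -- notation for the corners of `(E ⊞ B)_ℚ̄`
  set inlL := AbelianVariety.Hom.baseChange (AlgebraicClosure ℚ) (biprod.inl : E ⟶ E ⊞ B)
    with hinlL
  set fstL := AbelianVariety.Hom.baseChange (AlgebraicClosure ℚ) (biprod.fst : E ⊞ B ⟶ E)
    with hfstL
  set inrL := AbelianVariety.Hom.baseChange (AlgebraicClosure ℚ) (biprod.inr : B ⟶ E ⊞ B)
    with hinrL
  set sndL := AbelianVariety.Hom.baseChange (AlgebraicClosure ℚ) (biprod.snd : E ⊞ B ⟶ B)
    with hsndL
  have h_inl_fst : inlL ≫ fstL = 𝟙 _ := by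
    rw [hinlL, hfstL, ← AbelianVariety.Hom.baseChange_comp, biprod.inl_fst,
      AbelianVariety.Hom.baseChange_id]
  have h_inr_snd : inrL ≫ sndL = 𝟙 _ := by
    rw [hinrL, hsndL, ← AbelianVariety.Hom.baseChange_comp, biprod.inr_snd,
      AbelianVariety.Hom.baseChange_id]
  -- the Galois-fixed idempotents `ε_E = fst ≫ inl`, `ε_B = snd ≫ inr` of `(E ⊞ B)_ℚ̄`
  have hεE : ∀ σ : AlgebraicClosure ℚ ≃ₐ[ℚ] AlgebraicClosure ℚ,
      (E ⊞ B).galConj (AlgebraicClosure ℚ) σ (fstL ≫ inlL) = fstL ≫ inlL := fun σ ↦ by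
    rw [hfstL, hinlL, ← AbelianVariety.Hom.baseChange_comp]
    exact (E ⊞ B).galConj_baseChange (AlgebraicClosure ℚ) σ _
  have hεB : ∀ σ : AlgebraicClosure ℚ ≃ₐ[ℚ] AlgebraicClosure ℚ,
      (E ⊞ B).galConj (AlgebraicClosure ℚ) σ (sndL ≫ inrL) = sndL ≫ inrL := fun σ ↦ by
    rw [hsndL, hinrL, ← AbelianVariety.Hom.baseChange_comp]
    exact (E ⊞ B).galConj_baseChange (AlgebraicClosure ℚ) σ _
  -- the corner action, additive in `f`
  let corner (σ : AlgebraicClosure ℚ ≃ₐ[ℚ] AlgebraicClosure ℚ)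
      (f : E.baseChange (AlgebraicClosure ℚ) ⟶ B.baseChange (AlgebraicClosure ℚ)) :
      E.baseChange (AlgebraicClosure ℚ) ⟶ B.baseChange (AlgebraicClosure ℚ) :=
    inlL ≫ (E ⊞ B).galConj (AlgebraicClosure ℚ) σ (fstL ≫ f ≫ inrL) ≫ sndL
  have corner_add : ∀ σ f g, corner σ (f + g) = corner σ f + corner σ g := fun σ f g ↦ by
    simp only [corner, Preadditive.comp_add, Preadditive.add_comp,
      (E ⊞ B).galConj_add (AlgebraicClosure ℚ) σ]
  have corner_one : ∀ f, corner 1 f = f := fun f ↦ by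
    simp only [corner, (E ⊞ B).galConj_one (AlgebraicClosure ℚ), Category.assoc]
    rw [reassoc_of% h_inl_fst, h_inr_snd, Category.comp_id]
  have corner_mul : ∀ σ τ f, corner (σ * τ) f = corner σ (corner τ f) := fun σ τ f ↦ by
    simp only [corner]
    rw [(E ⊞ B).galConj_mul (AlgebraicClosure ℚ) σ τ]
    set Y := (E ⊞ B).galConj (AlgebraicClosure ℚ) τ (fstL ≫ f ≫ inrL) with hY
    rw [show fstL ≫ (inlL ≫ Y ≫ sndL) ≫ inrL = (fstL ≫ inlL) ≫ Y ≫ (sndL ≫ inrL) by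
        simp only [Category.assoc],
      (E ⊞ B).galConj_comp (AlgebraicClosure ℚ) σ (fstL ≫ inlL),
      (E ⊞ B).galConj_comp (AlgebraicClosure ℚ) σ Y (sndL ≫ inrL), hεE, hεB]
    simp only [Category.assoc]
    rw [reassoc_of% h_inl_fst, h_inr_snd, Category.comp_id]
  let ρ₀ (σ : AlgebraicClosure ℚ ≃ₐ[ℚ] AlgebraicClosure ℚ) :
      (E.baseChange (AlgebraicClosure ℚ) ⟶ B.baseChange (AlgebraicClosure ℚ)) →ₗ[ℤ]
        (E.baseChange (AlgebraicClosure ℚ) ⟶ B.baseChange (AlgebraicClosure ℚ)) :=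
    (AddMonoidHom.mk' (corner σ) (corner_add σ)).toIntLinearMap
  have ρ₀_apply : ∀ σ f, ρ₀ σ f = corner σ f := fun σ f ↦ rfl
  let ρ : Representation ℤ (AlgebraicClosure ℚ ≃ₐ[ℚ] AlgebraicClosure ℚ)
      (E.baseChange (AlgebraicClosure ℚ) ⟶ B.baseChange (AlgebraicClosure ℚ)) :=
    { toFun := ρ₀
      map_one' := by
        ext f
        rw [ρ₀_apply, corner_one]
        rfl
      map_mul' := fun σ τ ↦ by
        ext f
        rw [ρ₀_apply, corner_mul, Module.End.mul_apply, ρ₀_apply, ρ₀_apply] }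
  have ρ_apply : ∀ σ f, ρ σ f = corner σ f := fun σ f ↦ rfl
  refine ⟨ρ, fun σ f ↦ rfl, ?_, fun f ↦ ⟨fun hf ↦ ?_, ?_⟩⟩
  · -- finite image: `ρ σ` only depends on the ring automorphism `σ • ·` of `End((E ⊞ B)_ℚ̄)`
    have hfin := (E ⊞ B).finite_range_toRingHom_galois (AbelianVariety.module_finite_hom_holds _ _)
      AbelianVariety.isTorsionFree_int_hom_of_charZero
    let Ψ : (End ((E ⊞ B).baseChange (AlgebraicClosure ℚ)) →+*
        End ((E ⊞ B).baseChange (AlgebraicClosure ℚ))) →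
        ((E.baseChange (AlgebraicClosure ℚ) ⟶ B.baseChange (AlgebraicClosure ℚ)) →ₗ[ℤ]
          (E.baseChange (AlgebraicClosure ℚ) ⟶ B.baseChange (AlgebraicClosure ℚ))) := fun t ↦
      (AddMonoidHom.mk' (fun f ↦ inlL ≫ End.asHom (t (End.of (fstL ≫ f ≫ inrL))) ≫ sndL)
        (fun f g ↦ by
          have h : t (End.of (fstL ≫ (f + g) ≫ inrL)) =
              t (End.of (fstL ≫ f ≫ inrL)) + t (End.of (fstL ≫ g ≫ inrL)) := by
            rw [← t.map_add]
            congr 1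
            change fstL ≫ (f + g) ≫ inrL = (fstL ≫ f ≫ inrL) + (fstL ≫ g ≫ inrL)
            simp only [Preadditive.comp_add, Preadditive.add_comp]
          change inlL ≫ (t (End.of (fstL ≫ (f + g) ≫ inrL))) ≫ sndL =
            inlL ≫ (t (End.of (fstL ≫ f ≫ inrL))) ≫ sndL +
              inlL ≫ (t (End.of (fstL ≫ g ≫ inrL))) ≫ sndL
          rw [h]
          change inlL ≫ (End.asHom (t (End.of (fstL ≫ f ≫ inrL))) +
              End.asHom (t (End.of (fstL ≫ g ≫ inrL)))) ≫ sndL = _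
          simp only [Preadditive.comp_add, Preadditive.add_comp])).toIntLinearMap
    refine (hfin.image Ψ).subset ?_
    rintro _ ⟨σ, rfl⟩
    refine ⟨MulSemiringAction.toRingHom _ _ σ, ⟨σ, rfl⟩, ?_⟩
    ext f
    rfl
  · -- a fixed `f` has a Galois-fixed middle `Y = fst ≫ f ≫ inr`, which descends
    have hYfix : ∀ σ : AlgebraicClosure ℚ ≃ₐ[ℚ] AlgebraicClosure ℚ,
        (E ⊞ B).galConj (AlgebraicClosure ℚ) σ (fstL ≫ f ≫ inrL) = fstL ≫ f ≫ inrL := fun σ ↦ by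
      have h := hf σ
      rw [ρ_apply] at h
      have hY' : fstL ≫ f ≫ inrL = (fstL ≫ inlL) ≫ (fstL ≫ f ≫ inrL) ≫ (sndL ≫ inrL) := by
        simp only [Category.assoc]
        rw [reassoc_of% h_inl_fst, reassoc_of% h_inr_snd]
      calc (E ⊞ B).galConj (AlgebraicClosure ℚ) σ (fstL ≫ f ≫ inrL)
          = (E ⊞ B).galConj (AlgebraicClosure ℚ) σ
              ((fstL ≫ inlL) ≫ (fstL ≫ f ≫ inrL) ≫ (sndL ≫ inrL)) := by rw [← hY']
        _ = (fstL ≫ inlL) ≫ (E ⊞ B).galConj (AlgebraicClosure ℚ) σ (fstL ≫ f ≫ inrL) ≫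
              (sndL ≫ inrL) := by
            rw [(E ⊞ B).galConj_comp (AlgebraicClosure ℚ) σ (fstL ≫ inlL),
              (E ⊞ B).galConj_comp (AlgebraicClosure ℚ) σ (fstL ≫ f ≫ inrL) (sndL ≫ inrL),
              hεE, hεB]
        _ = fstL ≫ (corner σ f) ≫ inrL := by simp only [corner, Category.assoc]
        _ = fstL ≫ f ≫ inrL := by rw [h]
    obtain ⟨g, hg⟩ :=
      (E ⊞ B).exists_baseChange_eq_of_forall_galConj_eq (AlgebraicClosure ℚ) _ hYfix
    refine ⟨biprod.inl ≫ g ≫ biprod.snd, ?_⟩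
    rw [AbelianVariety.Hom.baseChange_comp, AbelianVariety.Hom.baseChange_comp, hg, ← hinlL,
      ← hsndL]
    simp only [Category.assoc]
    rw [reassoc_of% h_inl_fst, h_inr_snd, Category.comp_id]
  · -- base changes are fixed
    rintro ⟨f₀, rfl⟩ σ
    rw [ρ_apply]
    simp only [corner]
    rw [hfstL, hinrL, ← AbelianVariety.Hom.baseChange_comp, ← AbelianVariety.Hom.baseChange_comp,
      (E ⊞ B).galConj_baseChange (AlgebraicClosure ℚ) σ, AbelianVariety.Hom.baseChange_comp,
      AbelianVariety.Hom.baseChange_comp, ← hfstL, ← hinrL]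
    simp only [Category.assoc]
    rw [reassoc_of% h_inl_fst, h_inr_snd, Category.comp_id]

/-- **(B') The Hom-lattice as a representation of `Γ_ℚ = Field.absoluteGaloisGroup ℚ`** (the
previous statement composed with the identification `Field.absoluteGaloisGroup.toAlgEquiv`).
[folklore] -/
theorem homGaloisLattice' (E B : AbelianVariety.{0} ℚ) :
    Module.Free ℤ (E.baseChange (AlgebraicClosure ℚ) ⟶ B.baseChange (AlgebraicClosure ℚ)) ∧
    Module.Finite ℤ (E.baseChange (AlgebraicClosure ℚ) ⟶ B.baseChange (AlgebraicClosure ℚ)) ∧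
    Module.finrank ℤ (E.baseChange (AlgebraicClosure ℚ) ⟶ B.baseChange (AlgebraicClosure ℚ)) ≤
      4 * E.dim * B.dim ∧
    ∃ ρ : Representation ℤ (Field.absoluteGaloisGroup ℚ)
        (E.baseChange (AlgebraicClosure ℚ) ⟶ B.baseChange (AlgebraicClosure ℚ)),
      (∀ (σ : Field.absoluteGaloisGroup ℚ)
          (f : E.baseChange (AlgebraicClosure ℚ) ⟶ B.baseChange (AlgebraicClosure ℚ)),
          ρ σ f = AbelianVariety.Hom.baseChange (AlgebraicClosure ℚ) (biprod.inl : E ⟶ E ⊞ B) ≫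
            (E ⊞ B).galConj (AlgebraicClosure ℚ) (Field.absoluteGaloisGroup.toAlgEquiv ℚ σ)
              (AbelianVariety.Hom.baseChange (AlgebraicClosure ℚ) (biprod.fst : E ⊞ B ⟶ E) ≫ f ≫
                AbelianVariety.Hom.baseChange (AlgebraicClosure ℚ) (biprod.inr : B ⟶ E ⊞ B)) ≫
            AbelianVariety.Hom.baseChange (AlgebraicClosure ℚ) (biprod.snd : E ⊞ B ⟶ B)) ∧
      (Set.range ρ).Finite ∧
      ∀ f : E.baseChange (AlgebraicClosure ℚ) ⟶ B.baseChange (AlgebraicClosure ℚ),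
        (∀ σ : Field.absoluteGaloisGroup ℚ, ρ σ f = f) ↔
          ∃ f₀ : E ⟶ B, AbelianVariety.Hom.baseChange (AlgebraicClosure ℚ) f₀ = f := by
  obtain ⟨h1, h2, h3, ρ, hρ, hfin, hfix⟩ := homGaloisLattice E B
  refine ⟨h1, h2, h3, ρ.comp (Field.absoluteGaloisGroup.toAlgEquiv ℚ).toMonoidHom,
    fun σ f ↦ hρ _ f, ?_, fun f ↦ ?_⟩
  · refine hfin.subset ?_
    rintro _ ⟨σ, rfl⟩
    exact ⟨Field.absoluteGaloisGroup.toAlgEquiv ℚ σ, rfl⟩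
  · rw [← hfix f]
    constructor
    · intro h σ
      have h' := h ((Field.absoluteGaloisGroup.toAlgEquiv ℚ).symm σ)
      change ρ (Field.absoluteGaloisGroup.toAlgEquiv ℚ
        ((Field.absoluteGaloisGroup.toAlgEquiv ℚ).symm σ)) f = f at h'
      rwa [MulEquiv.apply_symm_apply] at h'
    · intro h σ
      exact h _

end BigImage

end Summit.ABC.ABC.Theorems.IsotypicMinkowski

end
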